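import Mathlib
import Summits.Ventures.PercRepro2.OneEdge
import Summits.Ventures.PercRepro2.KPrimeReduction
import Summits.Ventures.PercRepro2.KPrimeSure
import Summits.Ventures.PercRepro2.KPrimeEdgeSteps
import Summits.Ventures.PercRepro2.KPrimeVBase
import Summits.Ventures.PercRepro2.KPrimePendantLemmas
import Summits.Ventures.PercRepro2.KPrimePendantCore

/-!
# The pendant step of the `v`-exploration of `(K′)` is a theorem modulo the margin form `(K′-Ω+)`
(blind cell PercRepro2, mine-c g33; `conjectures/MINE-C.md` §42.3, §42.5)

Let `v` be a LEAF at `z` (its only edge `e = {v, z}`, weight `t = p e`), and let the `z`-INSTANCE be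
the same graph with `e` pinned closed and `z` in the role of `v` (marks `a₁ a₂ b z y`).  With
`Ω = {a₁ ↮ a₂}`, `N_z = {a₁ ↮ {a₂, z}}`, `S_z = {a₂ ↮ {a₁, z}}`, the exact PENDANT IDENTITY
(`MINE-C.md` §42.3; `pendant.py`, `pendid.py`; `pendant_core` in `KPrimePendantCore.lean`, by `ring`) reads, in cleared form,

  `P(Ω)·P(N_z)·P(S_z)·form_v(p) = (1−t)·S(t)·D(t)·P(N_z)·P(S_z)·C + t·S(t)·[P(Ω)·D(t)·form_z + (1−t)·Δ·B]
      + t(1−t)·P(Ω)·P(N_z)·U(t)·D`,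

with `S(t) = (1−t)P(Ω) + tP(S_z)`, `D(t) = (1−t)P(Ω) + tP(N_z)`, `C = P(b, y ∈ C₁, Ω)P(Ω) − P(b ∈ C₁, Ω)P(y ∈ C₁, Ω)`
(van den Berg–Kahn), `form_z` the cleared `(K′)` form of the `z`-instance,
`Δ = P(b ∈ C₁, Ω)P(N_z) − P(Ω)P(b ∈ C₁, N_z) ≥ 0` (the avoided lean drops; van den Berg–Kahn), `B` the
pendant bracket (UNSIGNED), `U(t) = P(b, z ∈ C₁, Ω)D(t) − N(t)P(z ∈ C₁, Ω) ≥ 0` and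
`D = P(y ∈ C₂, Ω)P(S_z) − P(Ω)P(y ∈ C₂, S_z) ≥ 0` (van den Berg–Kahn for `a₂`).

**Theorem** (`kprime_of_pendant`): `(K′)` for the `z`-instance together with its MARGIN FORM
`(K′-Ω+)`: `P(Ω)²·form_z + Δ·B ≥ 0` — i.e. `Φ_z(E_Ω) + (E_Ω − E₀)·(P(N_z)/P(S_z))·P(y ∈ C₁ | Ω) ≥ 0`
with `E_Ω = P(b ∈ C₁ | Ω)` the UNAVOIDED lean — gives `(K′)` for the pendant instance at EVERY
weight `t`: when `B ≤ 0` the margin form pays the bracket term, when `B ≥ 0` every term is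
non-negative.  `(K′-Ω+)` is census-true (`MINE-C.md` §42.5) and NOT proved here.
-/

namespace Summit.Ventures.PercRepro2

namespace KPrime

variable {V : Type*} {E : Type*} [Fintype E] [DecidableEq E] [Fintype V] [DecidableEq V]
  {R : Type*} [Field R] [LinearOrder R] [IsStrictOrderedRing R]


section PendantStep

variable {ends : E → Sym2 V} {a₁ a₂ b v y z : V} {p : E → R} {e : E}

omit [Fintype V] [DecidableEq V] [LinearOrder R] [IsStrictOrderedRing R] in
/-- With the pendant edge pinned closed, an event on which `a₁ ↔ v` is null. -/
lemma prob_update_zero_eq_zero_of_subset_U (hleaf : ∀ f, v ∈ ends f → f = e) (ha₁ : a₁ ≠ v)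
    {A : Set (Config E)} (hA : A ⊆ connEvent ends a₁ v) : prob (Function.update p e 0) A = 0 := by
  apply prob_eq_zero_of_inter_sureSet_eq_empty
  ext ω
  simp only [Set.mem_inter_iff, Set.mem_empty_iff_false, iff_false, not_and]
  intro hωA hω
  have hωe : ω e = false := hω.2 e (by simp)
  exact ha₁ (conn_eq_of_isolated hleaf hωe (conn_symm (hA hωA)))

/-- **The pendant step**: `(K′)` and `(K′-Ω+)` for the `z`-instance (the pendant edge pinned
closed, `z` in the role of `v`) give `(K′)` for the instance with the leaf `v` at `z`, at every
weight of the pendant edge (`MINE-C.md` §42.3; the identity `pendant_core`). -/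
theorem kprime_of_pendant (hp : IsProbVec p) (hleaf : ∀ f, v ∈ ends f → f = e)
    (hends : ends e = s(v, z)) (he : p e ≠ 1) (hvz : v ≠ z) (ha₁ : a₁ ≠ v) (ha₂ : a₂ ≠ v)
    (hb : b ≠ v) (hy : y ≠ v)
    (hO : 0 < prob (Function.update p e 0) (Ω ends a₁ a₂))
    (hNz : 0 < prob (Function.update p e 0) (N ends a₁ a₂ z))
    (hSz : 0 < prob (Function.update p e 0) (S ends a₁ a₂ z))
    (H1 : KPrimeHolds ends a₁ a₂ b z y (Function.update p e 0))
    (H2 : 0 ≤ prob (Function.update p e 0) (Ω ends a₁ a₂) ^ 2 *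
        kprimeForm ends a₁ a₂ b z y (Function.update p e 0)
          (prob (Function.update p e 0) (connEvent ends a₁ b ∩ N ends a₁ a₂ z))
          (prob (Function.update p e 0) (N ends a₁ a₂ z)) +
      (prob (Function.update p e 0) (connEvent ends a₁ b ∩ Ω ends a₁ a₂) *
          prob (Function.update p e 0) (N ends a₁ a₂ z) -
        prob (Function.update p e 0) (Ω ends a₁ a₂) *
          prob (Function.update p e 0) (connEvent ends a₁ b ∩ N ends a₁ a₂ z)) *
      (prob (Function.update p e 0) (N ends a₁ a₂ z) *
          prob (Function.update p e 0) (connEvent ends a₁ y ∩ Ω ends a₁ a₂) *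
          prob (Function.update p e 0) (S ends a₁ a₂ z) -
        prob (Function.update p e 0) (Ω ends a₁ a₂) *
          (prob (Function.update p e 0) (cls01 ends a₁ a₂ z y) *
              prob (Function.update p e 0) (S ends a₁ a₂ z) -
            prob (Function.update p e 0)
                (connEvent ends a₁ z ∩ connEvent ends a₂ y ∩ Ω ends a₁ a₂) *
              prob (Function.update p e 0) (S ends a₁ a₂ z) +
            prob (Function.update p e 0) (connEvent ends a₁ z ∩ Ω ends a₁ a₂) *
              prob (Function.update p e 0) (connEvent ends a₂ y ∩ S ends a₁ a₂ z)))) :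
    KPrimeHolds ends a₁ a₂ b v y p := by
  have hp0v : IsProbVec (Function.update p e 0) := hp.update e le_rfl zero_le_one
  -- sure facts with `e` pinned closed: `v` is isolated
  have iso : ∀ {ω : Config E}, ω ∈ sureSet (Function.update p e 0) → ∀ {x : V},
      Conn ends ω x v → x = v := by
    intro ω hω x h
    exact conn_eq_of_isolated hleaf (hω.2 e (by simp)) (conn_symm h)
  -- sure facts with `e` pinned open: `v` is what `z` is
  have dict : ∀ {ω : Config E}, ω ∈ sureSet (Function.update p e 1) → ∀ {a : V}, a ≠ v →
      (Conn ends ω a v ↔ Conn ends ω a z) := by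
    intro ω hω a ha
    exact conn_v_iff_conn_z_of_mem_sureSet_update_one hleaf hends hvz hω ha
  /- ## world 0: the `U`-masses vanish, `S = N = Ω`, the classes -/
  have z1 : prob (Function.update p e 0)
      (connEvent ends a₁ v ∩ connEvent ends a₁ b ∩ Ω ends a₁ a₂) = 0 :=
    prob_update_zero_eq_zero_of_subset_U hleaf ha₁ (fun ω hω => hω.1.1)
  have z2 : prob (Function.update p e 0) (connEvent ends a₁ v ∩ Ω ends a₁ a₂) = 0 :=
    prob_update_zero_eq_zero_of_subset_U hleaf ha₁ (fun ω hω => hω.1)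
  have z3 : prob (Function.update p e 0) (connEvent ends a₁ v ∩ connEvent ends a₂ y ∩
      connEvent ends a₁ b ∩ Ω ends a₁ a₂) = 0 :=
    prob_update_zero_eq_zero_of_subset_U hleaf ha₁ (fun ω hω => hω.1.1.1)
  have z4 : prob (Function.update p e 0)
      (connEvent ends a₁ v ∩ connEvent ends a₂ y ∩ Ω ends a₁ a₂) = 0 :=
    prob_update_zero_eq_zero_of_subset_U hleaf ha₁ (fun ω hω => hω.1.1)
  have eS0 : prob (Function.update p e 0) (S ends a₁ a₂ v) =
      prob (Function.update p e 0) (Ω ends a₁ a₂) := by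
    apply prob_congr_sure; ext ω
    simp only [Set.mem_inter_iff, mem_S, mem_Ω]
    constructor
    · rintro ⟨⟨ha, _⟩, hs⟩; exact ⟨fun h => ha (conn_symm h), hs⟩
    · rintro ⟨ha, hs⟩; exact ⟨⟨fun h => ha (conn_symm h), fun h => ha₂ (iso hs h)⟩, hs⟩
  have eYS0 : prob (Function.update p e 0) (connEvent ends a₂ y ∩ S ends a₁ a₂ v) =
      prob (Function.update p e 0) (connEvent ends a₂ y ∩ Ω ends a₁ a₂) := by
    apply prob_congr_sure; ext ω
    simp only [Set.mem_inter_iff, mem_S, mem_Ω, mem_connEvent]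
    constructor
    · rintro ⟨⟨hy', ha, _⟩, hs⟩; exact ⟨⟨hy', fun h => ha (conn_symm h)⟩, hs⟩
    · rintro ⟨⟨hy', ha⟩, hs⟩
      exact ⟨⟨hy', fun h => ha (conn_symm h), fun h => ha₂ (iso hs h)⟩, hs⟩
  have eN0 : prob (Function.update p e 0) (N ends a₁ a₂ v) =
      prob (Function.update p e 0) (Ω ends a₁ a₂) := by
    apply prob_congr_sure; ext ω
    simp only [Set.mem_inter_iff, mem_N, mem_Ω]
    constructor
    · rintro ⟨⟨ha, _⟩, hs⟩; exact ⟨ha, hs⟩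
    · rintro ⟨ha, hs⟩; exact ⟨⟨ha, fun h => ha₁ (iso hs h)⟩, hs⟩
  have eXN0 : prob (Function.update p e 0) (connEvent ends a₁ b ∩ N ends a₁ a₂ v) =
      prob (Function.update p e 0) (connEvent ends a₁ b ∩ Ω ends a₁ a₂) := by
    apply prob_congr_sure; ext ω
    simp only [Set.mem_inter_iff, mem_N, mem_Ω]
    constructor
    · rintro ⟨⟨hb', ha, _⟩, hs⟩; exact ⟨⟨hb', ha⟩, hs⟩
    · rintro ⟨⟨hb', ha⟩, hs⟩; exact ⟨⟨hb', ha, fun h => ha₁ (iso hs h)⟩, hs⟩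
  have e010 : prob (Function.update p e 0) (cls01 ends a₁ a₂ v y) =
      prob (Function.update p e 0) (connEvent ends a₁ y ∩ Ω ends a₁ a₂) := by
    apply prob_congr_sure; ext ω
    simp only [cls01, Set.mem_inter_iff, Set.mem_compl_iff, mem_connEvent, mem_S, mem_Ω]
    constructor
    · rintro ⟨⟨⟨_, hy'⟩, ha, _⟩, hs⟩; exact ⟨⟨hy', fun h => ha (conn_symm h)⟩, hs⟩
    · rintro ⟨⟨hy', ha⟩, hs⟩
      exact ⟨⟨⟨fun h => ha₁ (iso hs h), hy'⟩, fun h => ha (conn_symm h), fun h => ha₂ (iso hs h)⟩,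
        hs⟩
  have e01e0 : prob (Function.update p e 0) (cls01e ends a₁ a₂ b v y) =
      prob (Function.update p e 0) (connEvent ends a₁ b ∩ connEvent ends a₁ y ∩ Ω ends a₁ a₂) := by
    apply prob_congr_sure; ext ω
    simp only [cls01e, Set.mem_inter_iff, Set.mem_compl_iff, Set.mem_union, mem_connEvent, mem_S,
      mem_Ω]
    constructor
    · rintro ⟨⟨⟨⟨_, hy'⟩, ha, _⟩, hbb⟩, hs⟩
      refine ⟨⟨⟨?_, hy'⟩, fun h => ha (conn_symm h)⟩, hs⟩
      rcases hbb with h | h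
      · exact h
      · exact absurd (iso hs (conn_symm h)) hb
    · rintro ⟨⟨⟨hbb, hy'⟩, ha⟩, hs⟩
      exact ⟨⟨⟨⟨fun h => ha₁ (iso hs h), hy'⟩, fun h => ha (conn_symm h), fun h => ha₂ (iso hs h)⟩,
        Or.inl hbb⟩, hs⟩
  /- ## world 1: the `v`-events are the `z`-events, whose masses are flip-invariant -/
  have hz1 : z ≠ v := fun h => hvz h.symm
  have fa₁ : ∀ x, x ≠ v → FlipInvAt p e (connEvent ends a₁ x) :=
    fun x hx => flipInvAt_connEvent hleaf hends ha₁ hx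
  have fa₂ : ∀ x, x ≠ v → FlipInvAt p e (connEvent ends a₂ x) :=
    fun x hx => flipInvAt_connEvent hleaf hends ha₂ hx
  have fΩ : FlipInvAt p e (Ω ends a₁ a₂) :=
    flipInvAt_avoidAll hleaf hends ha₁ (by simp [ha₂])
  have fSz : FlipInvAt p e (S ends a₁ a₂ z) :=
    flipInvAt_avoidAll hleaf hends ha₂ (by simp [ha₁, hz1])
  have fNz : FlipInvAt p e (N ends a₁ a₂ z) :=
    flipInvAt_avoidAll hleaf hends ha₁ (by simp [ha₂, hz1])
  have fzb : FlipInvAt p e (connEvent ends z b) := flipInvAt_connEvent hleaf hends hz1 hb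
  have f01 : FlipInvAt p e (cls01 ends a₁ a₂ z y) :=
    ((fa₁ z hz1).compl.inter (fa₁ y hy)).inter fSz
  have f01e : FlipInvAt p e (cls01e ends a₁ a₂ b z y) :=
    f01.inter ((fa₁ b hb).union fzb)
  have flip : ∀ {A : Set (Config E)}, FlipInvAt p e A →
      prob (Function.update p e 1) A = prob (Function.update p e 0) A :=
    fun hA => prob_update_one_eq_update_zero_of_flipInvAt he hA
  -- the dictionary, event by event (on the sure set of `e` pinned open)
  have d1 : prob (Function.update p e 1) (connEvent ends a₁ v ∩ connEvent ends a₁ b ∩ Ω ends a₁ a₂)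
      = prob (Function.update p e 0) (connEvent ends a₁ b ∩ connEvent ends a₁ z ∩ Ω ends a₁ a₂) := by
    rw [← flip (((fa₁ b hb).inter (fa₁ z hz1)).inter fΩ)]
    apply prob_congr_sure; ext ω
    simp only [Set.mem_inter_iff, mem_connEvent]
    constructor
    · rintro ⟨⟨⟨hu, hx⟩, hΩ⟩, hs⟩; exact ⟨⟨⟨hx, (dict hs ha₁).1 hu⟩, hΩ⟩, hs⟩
    · rintro ⟨⟨⟨hx, hu⟩, hΩ⟩, hs⟩; exact ⟨⟨⟨(dict hs ha₁).2 hu, hx⟩, hΩ⟩, hs⟩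
  have d2 : prob (Function.update p e 1) (connEvent ends a₁ v ∩ Ω ends a₁ a₂) =
      prob (Function.update p e 0) (connEvent ends a₁ z ∩ Ω ends a₁ a₂) := by
    rw [← flip ((fa₁ z hz1).inter fΩ)]
    apply prob_congr_sure; ext ω
    simp only [Set.mem_inter_iff, mem_connEvent]
    constructor
    · rintro ⟨⟨hu, hΩ⟩, hs⟩; exact ⟨⟨(dict hs ha₁).1 hu, hΩ⟩, hs⟩
    · rintro ⟨⟨hu, hΩ⟩, hs⟩; exact ⟨⟨(dict hs ha₁).2 hu, hΩ⟩, hs⟩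
  have d3 : prob (Function.update p e 1) (connEvent ends a₁ v ∩ connEvent ends a₂ y ∩
      connEvent ends a₁ b ∩ Ω ends a₁ a₂) =
      prob (Function.update p e 0) (connEvent ends a₁ z ∩ connEvent ends a₂ y ∩
        connEvent ends a₁ b ∩ Ω ends a₁ a₂) := by
    rw [← flip ((((fa₁ z hz1).inter (fa₂ y hy)).inter (fa₁ b hb)).inter fΩ)]
    apply prob_congr_sure; ext ω
    simp only [Set.mem_inter_iff, mem_connEvent]
    constructor
    · rintro ⟨⟨⟨⟨hu, hy'⟩, hx⟩, hΩ⟩, hs⟩; exact ⟨⟨⟨⟨(dict hs ha₁).1 hu, hy'⟩, hx⟩, hΩ⟩, hs⟩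
    · rintro ⟨⟨⟨⟨hu, hy'⟩, hx⟩, hΩ⟩, hs⟩; exact ⟨⟨⟨⟨(dict hs ha₁).2 hu, hy'⟩, hx⟩, hΩ⟩, hs⟩
  have d4 : prob (Function.update p e 1) (connEvent ends a₁ v ∩ connEvent ends a₂ y ∩ Ω ends a₁ a₂)
      = prob (Function.update p e 0) (connEvent ends a₁ z ∩ connEvent ends a₂ y ∩ Ω ends a₁ a₂) := by
    rw [← flip (((fa₁ z hz1).inter (fa₂ y hy)).inter fΩ)]
    apply prob_congr_sure; ext ω
    simp only [Set.mem_inter_iff, mem_connEvent]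
    constructor
    · rintro ⟨⟨⟨hu, hy'⟩, hΩ⟩, hs⟩; exact ⟨⟨⟨(dict hs ha₁).1 hu, hy'⟩, hΩ⟩, hs⟩
    · rintro ⟨⟨⟨hu, hy'⟩, hΩ⟩, hs⟩; exact ⟨⟨⟨(dict hs ha₁).2 hu, hy'⟩, hΩ⟩, hs⟩
  have dS : prob (Function.update p e 1) (S ends a₁ a₂ v) =
      prob (Function.update p e 0) (S ends a₁ a₂ z) := by
    rw [← flip fSz]
    apply prob_congr_sure; ext ω
    simp only [Set.mem_inter_iff, mem_S]
    constructor
    · rintro ⟨⟨ha, hv'⟩, hs⟩; exact ⟨⟨ha, fun h => hv' ((dict hs ha₂).2 h)⟩, hs⟩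
    · rintro ⟨⟨ha, hz'⟩, hs⟩; exact ⟨⟨ha, fun h => hz' ((dict hs ha₂).1 h)⟩, hs⟩
  have dYS : prob (Function.update p e 1) (connEvent ends a₂ y ∩ S ends a₁ a₂ v) =
      prob (Function.update p e 0) (connEvent ends a₂ y ∩ S ends a₁ a₂ z) := by
    rw [← flip ((fa₂ y hy).inter fSz)]
    apply prob_congr_sure; ext ω
    simp only [Set.mem_inter_iff, mem_S, mem_connEvent]
    constructor
    · rintro ⟨⟨hy', ha, hv'⟩, hs⟩; exact ⟨⟨hy', ha, fun h => hv' ((dict hs ha₂).2 h)⟩, hs⟩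
    · rintro ⟨⟨hy', ha, hz'⟩, hs⟩; exact ⟨⟨hy', ha, fun h => hz' ((dict hs ha₂).1 h)⟩, hs⟩
  have dN : prob (Function.update p e 1) (N ends a₁ a₂ v) =
      prob (Function.update p e 0) (N ends a₁ a₂ z) := by
    rw [← flip fNz]
    apply prob_congr_sure; ext ω
    simp only [Set.mem_inter_iff, mem_N]
    constructor
    · rintro ⟨⟨ha, hv'⟩, hs⟩; exact ⟨⟨ha, fun h => hv' ((dict hs ha₁).2 h)⟩, hs⟩
    · rintro ⟨⟨ha, hz'⟩, hs⟩; exact ⟨⟨ha, fun h => hz' ((dict hs ha₁).1 h)⟩, hs⟩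
  have dXN : prob (Function.update p e 1) (connEvent ends a₁ b ∩ N ends a₁ a₂ v) =
      prob (Function.update p e 0) (connEvent ends a₁ b ∩ N ends a₁ a₂ z) := by
    rw [← flip ((fa₁ b hb).inter fNz)]
    apply prob_congr_sure; ext ω
    simp only [Set.mem_inter_iff, mem_N, mem_connEvent]
    constructor
    · rintro ⟨⟨hb', ha, hv'⟩, hs⟩; exact ⟨⟨hb', ha, fun h => hv' ((dict hs ha₁).2 h)⟩, hs⟩
    · rintro ⟨⟨hb', ha, hz'⟩, hs⟩; exact ⟨⟨hb', ha, fun h => hz' ((dict hs ha₁).1 h)⟩, hs⟩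
  have d01 : prob (Function.update p e 1) (cls01 ends a₁ a₂ v y) =
      prob (Function.update p e 0) (cls01 ends a₁ a₂ z y) := by
    rw [← flip f01]
    apply prob_congr_sure; ext ω
    simp only [cls01, Set.mem_inter_iff, Set.mem_compl_iff, mem_connEvent, mem_S]
    constructor
    · rintro ⟨⟨⟨hu, hy'⟩, ha, hv'⟩, hs⟩
      exact ⟨⟨⟨fun h => hu ((dict hs ha₁).2 h), hy'⟩, ha, fun h => hv' ((dict hs ha₂).2 h)⟩, hs⟩
    · rintro ⟨⟨⟨hu, hy'⟩, ha, hz'⟩, hs⟩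
      exact ⟨⟨⟨fun h => hu ((dict hs ha₁).1 h), hy'⟩, ha, fun h => hz' ((dict hs ha₂).1 h)⟩, hs⟩
  have d01e : prob (Function.update p e 1) (cls01e ends a₁ a₂ b v y) =
      prob (Function.update p e 0) (cls01e ends a₁ a₂ b z y) := by
    rw [← flip f01e]
    apply prob_congr_sure; ext ω
    simp only [cls01e, Set.mem_inter_iff, Set.mem_compl_iff, Set.mem_union, mem_connEvent, mem_S]
    constructor
    · rintro ⟨⟨⟨⟨hu, hy'⟩, ha, hv'⟩, hbb⟩, hs⟩
      refine ⟨⟨⟨⟨fun h => hu ((dict hs ha₁).2 h), hy'⟩, ha, fun h => hv' ((dict hs ha₂).2 h)⟩, ?_⟩,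
        hs⟩
      rcases hbb with h | h
      · exact Or.inl h
      · exact Or.inr (conn_symm ((dict hs hb).1 (conn_symm h)))
    · rintro ⟨⟨⟨⟨hu, hy'⟩, ha, hz'⟩, hbb⟩, hs⟩
      refine ⟨⟨⟨⟨fun h => hu ((dict hs ha₁).1 h), hy'⟩, ha, fun h => hz' ((dict hs ha₂).1 h)⟩, ?_⟩,
        hs⟩
      rcases hbb with h | h
      · exact Or.inl h
      · exact Or.inr (conn_symm ((dict hs hb).2 (conn_symm h)))
  /- ## the three van den Berg–Kahn inequalities and the complement decompositions -/
  have hΩc := Ω_eq_compl (ends := ends) (a₁ := a₁) (a₂ := a₂)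
  have vC := vdBK_pair (Function.update p e 0) hp0v ends a₁ b y a₂
  rw [← hΩc] at vC
  have vZ := vdBK_pair (Function.update p e 0) hp0v ends a₁ b z a₂
  rw [← hΩc] at vZ
  have vY := vdBK_pair (Function.update p e 0) hp0v ends a₂ y z a₁
  have hΩ' : (connEvent ends a₂ a₁)ᶜ = Ω ends a₁ a₂ := by
    ext ω; simp only [Set.mem_compl_iff, mem_connEvent, mem_Ω]
    exact ⟨fun h hc => h (conn_symm hc), fun h hc => h (conn_symm hc)⟩
  rw [hΩ'] at vY
  have hNz' : N ends a₁ a₂ z = Ω ends a₁ a₂ ∩ (connEvent ends a₁ z)ᶜ := by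
    ext ω; simp only [mem_N, Set.mem_inter_iff, mem_Ω, Set.mem_compl_iff, mem_connEvent]
  have hSz' : S ends a₁ a₂ z = Ω ends a₁ a₂ ∩ (connEvent ends a₂ z)ᶜ := by
    ext ω; simp only [mem_S, Set.mem_inter_iff, mem_Ω, Set.mem_compl_iff, mem_connEvent]
    exact ⟨fun h => ⟨fun hc => h.1 (conn_symm hc), h.2⟩, fun h => ⟨fun hc => h.1 (conn_symm hc), h.2⟩⟩
  have cN : prob (Function.update p e 0) (connEvent ends a₁ z ∩ Ω ends a₁ a₂) +
      prob (Function.update p e 0) (N ends a₁ a₂ z) = prob (Function.update p e 0) (Ω ends a₁ a₂) := by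
    rw [hNz', Set.inter_comm (connEvent ends a₁ z)]; exact prob_inter_add_prob_inter_compl _ _ _
  have cXN : prob (Function.update p e 0) (connEvent ends a₁ b ∩ connEvent ends a₁ z ∩ Ω ends a₁ a₂) +
      prob (Function.update p e 0) (connEvent ends a₁ b ∩ N ends a₁ a₂ z) =
      prob (Function.update p e 0) (connEvent ends a₁ b ∩ Ω ends a₁ a₂) := by
    have e1 : connEvent ends a₁ b ∩ connEvent ends a₁ z ∩ Ω ends a₁ a₂ =
        connEvent ends a₁ b ∩ Ω ends a₁ a₂ ∩ connEvent ends a₁ z := by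
      rw [Set.inter_assoc, Set.inter_comm (connEvent ends a₁ z), ← Set.inter_assoc]
    rw [e1, hNz', ← Set.inter_assoc]; exact prob_inter_add_prob_inter_compl _ _ _
  have cS : prob (Function.update p e 0) (connEvent ends a₂ z ∩ Ω ends a₁ a₂) +
      prob (Function.update p e 0) (S ends a₁ a₂ z) = prob (Function.update p e 0) (Ω ends a₁ a₂) := by
    rw [hSz', Set.inter_comm (connEvent ends a₂ z)]; exact prob_inter_add_prob_inter_compl _ _ _
  have cYS : prob (Function.update p e 0) (connEvent ends a₂ y ∩ connEvent ends a₂ z ∩ Ω ends a₁ a₂) +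
      prob (Function.update p e 0) (connEvent ends a₂ y ∩ S ends a₁ a₂ z) =
      prob (Function.update p e 0) (connEvent ends a₂ y ∩ Ω ends a₁ a₂) := by
    have e1 : connEvent ends a₂ y ∩ connEvent ends a₂ z ∩ Ω ends a₁ a₂ =
        connEvent ends a₂ y ∩ Ω ends a₁ a₂ ∩ connEvent ends a₂ z := by
      rw [Set.inter_assoc, Set.inter_comm (connEvent ends a₂ z), ← Set.inter_assoc]
    rw [e1, hSz', ← Set.inter_assoc]; exact prob_inter_add_prob_inter_compl _ _ _
  /- ## the algebra -/
  have e5 : connEvent ends a₁ z ∩ connEvent ends a₁ b ∩ Ω ends a₁ a₂ =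
      connEvent ends a₁ b ∩ connEvent ends a₁ z ∩ Ω ends a₁ a₂ := by
    rw [Set.inter_comm (connEvent ends a₁ z)]
  unfold KPrimeHolds at H1 ⊢
  unfold kprimeForm at H1 H2 ⊢
  rw [e5] at H1 H2
  rw [prob_eq_pin p (connEvent ends a₁ v ∩ connEvent ends a₁ b ∩ Ω ends a₁ a₂) e,
    prob_eq_pin p (connEvent ends a₁ v ∩ Ω ends a₁ a₂) e,
    prob_eq_pin p (connEvent ends a₂ y ∩ S ends a₁ a₂ v) e,
    prob_eq_pin p (S ends a₁ a₂ v) e,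
    prob_eq_pin p (cls01e ends a₁ a₂ b v y) e, prob_eq_pin p (cls01 ends a₁ a₂ v y) e,
    prob_eq_pin p (connEvent ends a₁ v ∩ connEvent ends a₂ y ∩ connEvent ends a₁ b ∩ Ω ends a₁ a₂) e,
    prob_eq_pin p (connEvent ends a₁ v ∩ connEvent ends a₂ y ∩ Ω ends a₁ a₂) e,
    prob_eq_pin p (connEvent ends a₁ b ∩ N ends a₁ a₂ v) e, prob_eq_pin p (N ends a₁ a₂ v) e]
  rw [z1, z2, z3, z4, eS0, eYS0, eN0, eXN0, e010, e01e0, d1, d2, d3, d4, dS, dYS, dN, dXN, d01, d01e]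
  have hHh : 0 ≤ prob (Function.update p e 0) (connEvent ends a₁ z ∩ Ω ends a₁ a₂) :=
    prob_nonneg hp0v _
  have core := pendant_core (p e) (prob (Function.update p e 0) (Ω ends a₁ a₂))
    (prob (Function.update p e 0) (connEvent ends a₁ b ∩ Ω ends a₁ a₂))
    (prob (Function.update p e 0) (connEvent ends a₁ y ∩ Ω ends a₁ a₂))
    (prob (Function.update p e 0) (connEvent ends a₁ b ∩ connEvent ends a₁ y ∩ Ω ends a₁ a₂))
    (prob (Function.update p e 0) (connEvent ends a₂ y ∩ Ω ends a₁ a₂))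
    (prob (Function.update p e 0) (S ends a₁ a₂ z))
    (prob (Function.update p e 0) (connEvent ends a₂ y ∩ S ends a₁ a₂ z))
    (prob (Function.update p e 0) (N ends a₁ a₂ z))
    (prob (Function.update p e 0) (connEvent ends a₁ b ∩ N ends a₁ a₂ z))
    (prob (Function.update p e 0) (connEvent ends a₁ b ∩ connEvent ends a₁ z ∩ Ω ends a₁ a₂))
    (prob (Function.update p e 0) (connEvent ends a₁ z ∩ Ω ends a₁ a₂))
    (prob (Function.update p e 0) (cls01e ends a₁ a₂ b z y))
    (prob (Function.update p e 0) (cls01 ends a₁ a₂ z y))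
    (prob (Function.update p e 0)
      (connEvent ends a₁ z ∩ connEvent ends a₂ y ∩ connEvent ends a₁ b ∩ Ω ends a₁ a₂))
    (prob (Function.update p e 0) (connEvent ends a₁ z ∩ connEvent ends a₂ y ∩ Ω ends a₁ a₂))
    (prob (Function.update p e 0) (connEvent ends a₂ z ∩ Ω ends a₁ a₂))
    (prob (Function.update p e 0) (connEvent ends a₂ y ∩ connEvent ends a₂ z ∩ Ω ends a₁ a₂))
    (hp.nonneg e) (hp.le_one e) hO hNz hSz hHh vC vZ cN cXN vY cS cYS H1 H2
  linarith [core]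

end PendantStep

end KPrime

end Summit.Ventures.PercRepro2
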